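/-
Copyright: cell pub-balaban-gaps (YM BLITZ Y1, track G1), seat g1-p2 GEN 4 (unit `pub-balaban-gaps-g1-p2`).  Row (D4) NODE O,
OBJECT ∕ MECHANISM level: the NEUMANN step in the BLOCK currency (`Gaps/D4WalkBlock`, rung §5 of `BLOCKNORM-ADAPTER.md`): the inverse
`(A + tP)⁻¹` of a block-walk-expanded pencil is a block walk expansion whose margin `q = c·θ̄·c′` carries NO fibre factor — print's
«O(M⁻¹)·3^d·c₁ < 1 for M sufficiently large» shape ([B9] Thm 3.7, p. 422).  HONEST FRAMING: bookkeeping over hypothesis SHAPES and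
ne5's generic level-sum lemmas; nothing of Bałaban's constructed or asserted; (D4) NOT discharged (instance 0∕1); NOT BetaPertH, NOT
continuum, NOT Clay.
-/
import Summits.QuantumFields.BalabanUV.Gaps.D4WalkBlockProduct
import Summits.QuantumFields.BalabanUV.Gaps.D4WalkNeumann

/-!
# `Gaps.D4WalkBlockNeumann` — the inverse of a BLOCK-walk-expanded pencil is a block walk expansion, margin without fibre factor
# (cell pub-balaban-gaps, seat g1-p2 gen 4)

HONEST DEPENDENCY (cell pub-balaban, verbatim): continuum YM on T⁴ ⇐ BetaPertH ∧ nine spine estimates (0/9 proved);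
BetaPertH ⇐ (D1) ∧ (D4) ∧ CAP+tail.

[B9] (3.130) p. 421, p. 422; Thm 3.7 p. 409 *"N′θc₁(α) < 1 … for M sufficiently large"*.  `blockWalkExpansion_inv_pencil`: block walk
expansions of `C` (`A·C = 1`) and of the direction `P` on the cube torus, cube row sums `(σ, c)` and `(σ′, c′)`, a chain rate `ρ`
with window `ε` inside both factor windows, two boundary rates (`ρ + σ ≤ ρ_s`, `ρ_s + σ ≤ ρ_C`, `ρ_s ≤ ρ_P`; `κ + σ′ ≤ κ_s ≤ κ_P`,
`κ_s + σ′ ≤ κ_C`), `‖t‖ ≤ τ`, and the MARGIN `q = c·(c·K̄_C·(τK̄_P)·c′)·c′ < 1` — NO fibre letter — ⟹ `(A + tP)⁻¹` is a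
`BlockWalkExpansion` with the Neumann chains as terms, amplitudes `chainConst 1 c θ (A_C ω₀)`, distances `chainDist`, constant
`K̄_C(1 − q)⁻¹`.  Per-term BLOCK bound by `blockNorm_chain_le` (induction on `D4WalkBlockProduct.blockNorm_mul_le_of_walks`);
partial sums by ne5's `NeumannChainWalks.majSumLe_chain` at `m = 1`; the entrywise `hasSum` by ne5's GENERIC `NeumannLevelSums`
(`hasSum_levels`, `one_sub_mul_tsum_eq`) fed the block-derived entry majorants; `termAnalytic ∕ indep ∕ through` from `D4WalkNeumann`.
Value: kernel-checked bookkeeping; nothing of Bałaban's asserted; words of row (D4) UNCHANGED.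
-/

noncomputable section

namespace Summit.QuantumFields.BalabanUV.Gaps.D4WalkBlockNeumann

open Metric Set Finset
open Literature.MathematicalPhysics.QuantumFieldTheory.Balaban1983to89
open Literature.MathematicalPhysics.QuantumFieldTheory.Balaban1983to89.B9SectDWalk
  (Through MajSumLe DomBy infConv chainConst chainDist domBy_infConv domBy_chainDist through_chainDist_seed
    through_chainDist_mem through_infConv_left through_infConv_right chainConst_nonneg)
open Literature.MathematicalPhysics.QuantumFieldTheory.Balaban1983to89.B9Thm34Ext (toB6)
open Literature.MathematicalPhysics.QuantumFieldTheory.Balaban1983to89.B9Thm37GlueTorus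
  (torusGeom tdist1 tdist1_nonneg hdnn_torusGeom htri_torusGeom)
open Literature.MathematicalPhysics.QuantumFieldTheory.Balaban1983to89.TreeLengthTorus (TPt)
open Literature.MathematicalPhysics.QuantumFieldTheory.Balaban1983to89.B5TorusCover (UT)
open Literature.MathematicalPhysics.QuantumFieldTheory.Balaban1983to89.B11SectG (RowSum)
open Summit.QuantumFields.BalabanUV.T4Continuum.Spine.NE5.ProductWalks (majSumLe_mul)
open Summit.QuantumFields.BalabanUV.T4Continuum.Spine.NE5.NeumannChainWalks (majSumLe_chain chainDist_nonneg)
open Summit.QuantumFields.BalabanUV.T4Continuum.Spine.NE5.NeumannLevelSums (hasSum_levels one_sub_mul_tsum_eq)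
open Summit.QuantumFields.BalabanUV.Gaps.D4WalkBlock (blockNorm blockNorm_nonneg blockNorm_smul_le norm_entry_le_blockNorm BlockWalkExpansion)
open Summit.QuantumFields.BalabanUV.Gaps.D4WalkBlockProduct (blockNorm_mul_le_of_walks)
open Summit.QuantumFields.BalabanUV.Gaps.D4WalkNeumann (differentiableOn_neumannChain chain_congr)

variable {ν : ℕ} {K : Fin ν → ℕ} [∀ i, NeZero (K i)]
variable {d N' : ℕ} {n : Type} [Fintype n] [DecidableEq n]
variable {E : Type*} [NormedAddCommGroup E] [NormedSpace ℂ E]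

/-! ## §1. Block bound of a chain -/

omit [DecidableEq n] in
/-- **BLOCK BOUND OF A CHAIN** (print's (3.108) for a walk of one-step factors, in operator-norm currency): steps with block bounds
`θ_i e^{−δD_i}` (`D_i` dominating the cube distance), seed `A e^{−ρ_0 D₀}` (`D₀` dominating, `ρ ≤ ρ₀`), cube row sum `(σ, c)`,
`ρ + σ ≤ δ` ⟹ `‖S_{i₁}⋯S_{iₙ}T₀‖_{y,y′} ≤ chainConst 1 c θ A l · e^{−ρ·chainDist(y,y′)}` — every step pays ONE cube row sum, NO fibre.
[cite: Balaban1985BackgroundPropagators, (3.107)–(3.108) p.416, (3.92)–(3.94) p.410] -/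
theorem blockNorm_chain_le (cub : n → UT K) {ι : Type} {S : ι → Matrix n n ℂ} {T₀ : Matrix n n ℂ} {θ : ι → ℝ}
    {D : ι → UT K → UT K → ℝ} {D₀ : UT K → UT K → ℝ} {A ρ ρ₀ δ σ c : ℝ}
    (hθ : ∀ i, 0 ≤ θ i) (hA : 0 ≤ A) (hρ : 0 ≤ ρ) (hρ₀ : ρ ≤ ρ₀) (hσ : 0 ≤ σ) (hρδ : ρ + σ ≤ δ) (hc : 0 ≤ c)
    (hD : ∀ i, DomBy (toB6 (torusGeom K 0 0 0) 0 True) (D i)) (hD₀ : DomBy (toB6 (torusGeom K 0 0 0) 0 True) D₀)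
    (hrow : RowSum (toB6 (torusGeom K 0 0 0) 0 True) σ c)
    (hS : ∀ i y y', blockNorm cub cub (S i) y y' ≤ θ i * Real.exp (-(δ * D i y y')))
    (hT : ∀ y y', blockNorm cub cub T₀ y y' ≤ A * Real.exp (-(ρ₀ * D₀ y y'))) :
    ∀ (l : List ι) (y y' : UT K), blockNorm cub cub (l.foldr (fun i M => S i * M) T₀) y y' ≤
      chainConst 1 c θ A l * Real.exp (-(ρ * chainDist (g := toB6 (torusGeom K 0 0 0) 0 True) D D₀ l y y')) := by
  intro l
  induction l with
  | nil =>
      intro y y'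
      simp only [List.foldr_nil, B9SectDWalk.chainConst_nil, B9SectDWalk.chainDist_nil]
      exact (hT y y').trans (mul_le_mul_of_nonneg_left (Real.exp_le_exp.2
        (by nlinarith [(hdnn_torusGeom 0 0 0 y y').trans (hD₀ y y')])) hA)
  | cons i l ih =>
      intro y y'
      simp only [List.foldr_cons, B9SectDWalk.chainConst_cons, B9SectDWalk.chainDist_cons]
      have hAl : 0 ≤ chainConst 1 c θ A l := chainConst_nonneg zero_le_one hc hθ hA l
      have h := blockNorm_mul_le_of_walks cub cub cub (M₁ := S i) (M₂ := l.foldr (fun i M => S i * M) T₀)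
        (hθ i) hAl hρ le_rfl hσ hρδ (hD i) (fun a b => chainDist_nonneg hD hD₀ l a b) hrow (hS i) (fun y'' y' => ih y'' y') y y'
      calc blockNorm cub cub (S i * l.foldr (fun i M => S i * M) T₀) y y'
          ≤ (c * (θ i * chainConst 1 c θ A l)) *
              Real.exp (-(ρ * infConv (g := toB6 (torusGeom K 0 0 0) 0 True) (D i)
                (chainDist (g := toB6 (torusGeom K 0 0 0) 0 True) D D₀ l) y y')) := h
        _ = 1 * θ i * chainConst 1 c θ A l * c *
              Real.exp (-(ρ * infConv (g := toB6 (torusGeom K 0 0 0) 0 True) (D i)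
                (chainDist (g := toB6 (torusGeom K 0 0 0) 0 True) D D₀ l) y y')) := by ring

/-! ## §2. The inverse of a block-walk-expanded pencil -/

variable {c₀ : B13.Consts} {cub : n → UT K} {X : Finset (UT K)}
variable {WC WP : Type}
variable {TC : WC → (TPt d N' → ℂ) → E → Matrix n n ℂ} {Cm : (TPt d N' → ℂ) → E → Matrix n n ℂ}
variable {SXC : Set WC} {AC : WC → ℝ} {DC : WC → UT K → UT K → ℝ}
variable {TP : WP → (TPt d N' → ℂ) → E → Matrix n n ℂ} {Pm : (TPt d N' → ℂ) → E → Matrix n n ℂ}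
variable {SXP : Set WP} {AP : WP → ℝ} {DP : WP → UT K → UT K → ℝ}
variable {A : (TPt d N' → ℂ) → E → Matrix n n ℂ}
variable {R ρC εC κC KbarC ρP εP κP KbarP ρ ε ρs σ c σ' c' κs κ τ : ℝ} {t : ℂ}

/-- **THE INVERSE OF A BLOCK-WALK-EXPANDED PENCIL IS A BLOCK WALK EXPANSION — margin WITHOUT fibre factor.**  See the module docstring
for the data; rates: `0 ≤ ε ≤ ρ`, `ρ + σ ≤ ρ_s`, `ρ_s + σ ≤ ρ_C`, `ρ_s ≤ ρ_P`, windows `ρ_C − ε_C ≤ ρ − ε`, `ρ_P − ε_P ≤ ρ − ε`, torus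
rates `0 ≤ κ`, `κ + σ′ ≤ κ_s ≤ κ_P`, `κ_s + σ′ ≤ κ_C`, `κ ≤ κ_C`; margin `q = c(cK̄_C(τK̄_P)c′)c′ < 1`.
[cite: Balaban1985BackgroundPropagators, (3.130) p.421, p.422, Thm 3.7 p.409, (3.107)–(3.108) p.416; Balaban1988RG2Cluster, (1.11) p.5, p.13, p.15] -/
theorem blockWalkExpansion_inv_pencil
    (hC : BlockWalkExpansion c₀ cub cub Cm X R εC κC KbarC TC SXC AC DC ρC)
    (hP : BlockWalkExpansion c₀ cub cub Pm X R εP κP KbarP TP SXP AP DP ρP)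
    (hCdom : ∀ ω, DomBy (toB6 (torusGeom K 0 0 0) 0 True) (DC ω))
    (hPdom : ∀ ω, DomBy (toB6 (torusGeom K 0 0 0) 0 True) (DP ω))
    (hAC : ∀ σ₀ : TPt d N' → ℂ, (∀ j, ‖σ₀ j‖ ≤ Real.exp c₀.κ₁) → ∀ u ∈ ball (0 : E) R, A σ₀ u * Cm σ₀ u = 1)
    (hrow : RowSum (toB6 (torusGeom K 0 0 0) 0 True) σ c) (hrow' : RowSum (toB6 (torusGeom K 0 0 0) 0 True) σ' c')
    (hσ : 0 ≤ σ) (hσ' : 0 ≤ σ') (hc : 0 ≤ c) (hc' : 0 ≤ c')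
    (hε : 0 ≤ ε) (hερ : ε ≤ ρ) (hρs : ρ + σ ≤ ρs) (hρsC : ρs + σ ≤ ρC) (hρsP : ρs ≤ ρP)
    (hwC : ρC - εC ≤ ρ - ε) (hwP : ρP - εP ≤ ρ - ε)
    (hKC : 0 ≤ KbarC) (hKP : 0 ≤ KbarP)
    (hκs : 0 ≤ κs) (hκsP : κs ≤ κP) (hκsC : κs + σ' ≤ κC) (hκ : 0 ≤ κ) (hκC : κ ≤ κC) (hκκs : κ + σ' ≤ κs)
    (hτ : 0 ≤ τ) (ht : ‖t‖ ≤ τ)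
    (hq : c * (c * KbarC * (τ * KbarP) * c') * c' < 1) :
    BlockWalkExpansion c₀ cub cub (fun σ₀ u => (A σ₀ u + t • Pm σ₀ u)⁻¹) X R ε κ
      (KbarC * (1 - c * (c * KbarC * (τ * KbarP) * c') * c')⁻¹)
      (fun (p : List (WC × WP) × WC) σ₀ u =>
        p.1.foldr (fun i M => (TC i.1 σ₀ u * ((-t) • TP i.2 σ₀ u)) * M) (TC p.2 σ₀ u))
      {p | p.2 ∈ SXC ∨ ∃ i ∈ p.1, i.1 ∈ SXC ∨ i.2 ∈ SXP}
      (fun p => chainConst 1 c (fun i : WC × WP => c * (AC i.1 * (τ * AP i.2))) (AC p.2) p.1)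
      (fun p => chainDist (g := toB6 (torusGeom K 0 0 0) 0 True)
        (fun i : WC × WP => infConv (g := toB6 (torusGeom K 0 0 0) 0 True) (DC i.1) (DP i.2)) (DC p.2) p.1) ρ := by
  classical
  have hρ : 0 ≤ ρ := hε.trans hερ
  have hτAP : ∀ ω, 0 ≤ τ * AP ω := fun ω => mul_nonneg hτ (hP.A_nonneg ω)
  have hθ : ∀ i : WC × WP, 0 ≤ c * (AC i.1 * (τ * AP i.2)) :=
    fun i => mul_nonneg hc (mul_nonneg (hC.A_nonneg _) (hτAP _))
  have hDstep : ∀ i : WC × WP, DomBy (toB6 (torusGeom K 0 0 0) 0 True)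
      (infConv (g := toB6 (torusGeom K 0 0 0) 0 True) (DC i.1) (DP i.2)) :=
    fun i => domBy_infConv (htri_torusGeom 0 0 0 0 True) (hCdom i.1) (hPdom i.2)
  -- block bound of the scaled direction and of the step S_(ω₂,ω₁) = T_C ω₂ · (−t T_P ω₁) at rate ρ_s (T_C pays)
  have hP'B : ∀ ω, ∀ σ₀ : TPt d N' → ℂ, (∀ j, ‖σ₀ j‖ ≤ Real.exp c₀.κ₁) → ∀ u ∈ ball (0 : E) R,
      ∀ y y', blockNorm cub cub ((-t) • TP ω σ₀ u) y y' ≤ (τ * AP ω) * Real.exp (-(ρP * DP ω y y')) := by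
    intro ω σ₀ hσ₀ u hu y y'
    refine (blockNorm_smul_le cub cub (-t) (TP ω σ₀ u) y y').trans ?_
    rw [norm_neg, mul_assoc]
    exact mul_le_mul ht (hP.majB ω σ₀ hσ₀ u hu y y') (blockNorm_nonneg _ _ _ _ _) hτ
  have hStepB : ∀ (i : WC × WP) (σ₀ : TPt d N' → ℂ), (∀ j, ‖σ₀ j‖ ≤ Real.exp c₀.κ₁) → ∀ u ∈ ball (0 : E) R,
      ∀ y y', blockNorm cub cub (TC i.1 σ₀ u * ((-t) • TP i.2 σ₀ u)) y y' ≤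
        (c * (AC i.1 * (τ * AP i.2))) *
          Real.exp (-(ρs * infConv (g := toB6 (torusGeom K 0 0 0) 0 True) (DC i.1) (DP i.2) y y')) :=
    fun i σ₀ hσ₀ u hu y y' => blockNorm_mul_le_of_walks cub cub cub (hC.A_nonneg i.1) (hτAP i.2) (hρ.trans (by linarith))
      hρsP hσ hρsC (hCdom i.1) (hP.D_nonneg i.2) hrow (fun y y'' => hC.majB i.1 σ₀ hσ₀ u hu y y'')
      (fun y'' y' => hP'B i.2 σ₀ hσ₀ u hu y'' y') y y'
  -- per-term BLOCK bound of every chain at the chain rate ρ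
  have hchainB : ∀ (p : List (WC × WP) × WC) (σ₀ : TPt d N' → ℂ), (∀ j, ‖σ₀ j‖ ≤ Real.exp c₀.κ₁) → ∀ u ∈ ball (0 : E) R,
      ∀ y y', blockNorm cub cub (p.1.foldr (fun i M => (TC i.1 σ₀ u * ((-t) • TP i.2 σ₀ u)) * M) (TC p.2 σ₀ u)) y y' ≤
        chainConst 1 c (fun i : WC × WP => c * (AC i.1 * (τ * AP i.2))) (AC p.2) p.1 *
          Real.exp (-(ρ * chainDist (g := toB6 (torusGeom K 0 0 0) 0 True)
            (fun i : WC × WP => infConv (g := toB6 (torusGeom K 0 0 0) 0 True) (DC i.1) (DP i.2)) (DC p.2) p.1 y y')) :=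
    fun p σ₀ hσ₀ u hu => blockNorm_chain_le cub (S := fun i : WC × WP => TC i.1 σ₀ u * ((-t) • TP i.2 σ₀ u))
      (T₀ := TC p.2 σ₀ u) hθ (hC.A_nonneg p.2) hρ (by linarith) hσ hρs hc hDstep (hCdom p.2) hrow
      (fun i y y' => hStepB i σ₀ hσ₀ u hu y y') (fun y y' => hC.majB p.2 σ₀ hσ₀ u hu y y') p.1
  -- partial sums of the scaled direction and of the step family at the WINDOW rate ρ − ε
  have hP'ms : MajSumLe (g := toB6 (torusGeom K 0 0 0) 0 True) (fun ω a b => (τ * AP ω) * Real.exp (-((ρP - εP) * DP ω a b)))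
      (fun a b => (τ * KbarP) * Real.exp (-(κP * tdist1 K a b))) := by
    intro S a b
    have h := hP.majSum S a b
    calc ∑ ω ∈ S, τ * AP ω * Real.exp (-((ρP - εP) * DP ω a b))
        = τ * ∑ ω ∈ S, AP ω * Real.exp (-((ρP - εP) * DP ω a b)) := by
          rw [Finset.mul_sum]; exact Finset.sum_congr rfl fun ω _ => by ring
      _ ≤ τ * (KbarP * Real.exp (-(κP * tdist1 K a b))) := mul_le_mul_of_nonneg_left h hτ
      _ = (τ * KbarP) * Real.exp (-(κP * tdist1 K a b)) := by ring
  have hStepMS := majSumLe_mul (Nf := K) (C := c) (A₁ := AC) (A₂ := fun ω => τ * AP ω) (D₁ := DC) (D₂ := DP)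
    (ρ := ρ - ε) hC.A_nonneg hτAP (fun ω a b => (hdnn_torusGeom 0 0 0 a b).trans (hCdom ω a b))
    (fun ω a b => (hdnn_torusGeom 0 0 0 a b).trans (hPdom ω a b)) hwC hwP hc hKC (mul_nonneg hτ hKP) hκs hκsP hκsC hrow'
    hC.majSum hP'ms
  -- chain partial sums at rate ρ (per-term) and at rate ρ − ε (window), m = 1
  have hchainMS : ∀ ρ', ρ - ε ≤ ρ' → MajSumLe (g := toB6 (torusGeom K 0 0 0) 0 True)
      (fun (p : List (WC × WP) × WC) a b =>
        chainConst 1 c (fun i : WC × WP => c * (AC i.1 * (τ * AP i.2))) (AC p.2) p.1 *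
          Real.exp (-(ρ' * chainDist (g := toB6 (torusGeom K 0 0 0) 0 True)
            (fun i : WC × WP => infConv (g := toB6 (torusGeom K 0 0 0) 0 True) (DC i.1) (DP i.2)) (DC p.2) p.1 a b)))
      (fun a b => KbarC * (1 - c * (c * KbarC * (τ * KbarP) * c') * c')⁻¹ *
        Real.exp (-(κ * tdist1 K a b))) := by
    intro ρ' hρ'
    have h := majSumLe_chain (Nf := K) (ι := WC × WP) (W₀ := WC) (m := 1)
      (θ := fun i : WC × WP => c * (AC i.1 * (τ * AP i.2)))
      (D := fun i : WC × WP => infConv (g := toB6 (torusGeom K 0 0 0) 0 True) (DC i.1) (DP i.2)) (A₀ := AC) (D₀ := DC)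
      (ρ := ρ') (r := ρ - ε) (r₀ := ρC - εC) (c := c)
      hθ hC.A_nonneg hc hρ' (hwC.trans hρ') hDstep hCdom hrow' hσ'
      (mul_nonneg (mul_nonneg (mul_nonneg hc hKC) (mul_nonneg hτ hKP)) hc') hKC hκ hκC hκκs
      (by intro S a b; simpa only [mul_assoc] using hStepMS S a b) hC.majSum (by simpa only [Nat.cast_one, one_mul] using hq)
    intro S a b
    simpa only [mul_assoc, Nat.cast_one, one_mul] using h S a b
  refine
    { hasSum := ?_
      termAnalytic := fun p σ₀ hσ₀ a b => differentiableOn_neumannChain hC.termAnalytic hP.termAnalytic t σ₀ hσ₀ p.2 p.1 a b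
      majB := fun p σ₀ hσ₀ u hu y y' => hchainB p σ₀ hσ₀ u hu y y'
      majSum := hchainMS (ρ - ε) le_rfl
      indep := fun p hp σ₀ hσ₀ => by
        simp only [Set.mem_setOf_eq, not_or, not_exists, not_and] at hp
        refine chain_congr p.1 (fun i hi => ?_) (hC.indep p.2 hp.1 σ₀ hσ₀)
        obtain ⟨hi1, hi2⟩ := hp.2 i hi
        rw [hC.indep i.1 hi1 σ₀ hσ₀, hP.indep i.2 hi2 σ₀ hσ₀]
      through := fun p hp => by
        rcases hp with hseed | ⟨i, hi, hstep⟩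
        · exact through_chainDist_seed (htri_torusGeom 0 0 0 0 True) hDstep (hC.through p.2 hseed) p.1
        · refine through_chainDist_mem (htri_torusGeom 0 0 0 0 True) hDstep (hCdom p.2) ?_ p.1 hi
          rcases hstep with h | h
          · exact through_infConv_left (htri_torusGeom 0 0 0 0 True) (hC.through i.1 h) (hPdom i.2)
          · exact through_infConv_right (htri_torusGeom 0 0 0 0 True) (hCdom i.1) (hP.through i.2 h)
      A_nonneg := fun p => chainConst_nonneg zero_le_one hc hθ (hC.A_nonneg p.2) p.1
      D_nonneg := fun p a b => chainDist_nonneg hDstep (hCdom p.2) p.1 a b }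
  -- hasSum: levels KⁿC, remainder → 0, (1 − K)X = C, A(1 − K) = A + tP — ne5's generic level sums with the block-derived majorants
  intro σ₀ hσ₀ u hu i j
  have hSsum : ∀ a k, HasSum (fun ι' : WC × WP => (TC ι'.1 σ₀ u * ((-t) • TP ι'.2 σ₀ u)) a k)
      ((Cm σ₀ u * ((-t) • Pm σ₀ u)) a k) := by
    intro a k
    have hP'sum : ∀ a' k', HasSum (fun ω => ((-t) • TP ω σ₀ u) a' k') (((-t) • Pm σ₀ u) a' k') := by
      intro a' k'; simp only [Matrix.smul_apply, smul_eq_mul]; exact (hP.hasSum σ₀ hσ₀ u hu a' k').mul_left _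
    -- Cauchy product entrywise: Σ_k' T_C(a,k')·(−tT_P)(k',k)
    have e : (fun ι' : WC × WP => (TC ι'.1 σ₀ u * ((-t) • TP ι'.2 σ₀ u)) a k) =
        fun ι' => ∑ k', TC ι'.1 σ₀ u a k' * ((-t) • TP ι'.2 σ₀ u) k' k := funext fun ι' => Matrix.mul_apply
    rw [e, Matrix.mul_apply]
    refine hasSum_sum fun k' _ => ?_
    have ha0 : ∀ ω, 0 ≤ AC ω * Real.exp (-(ρC * DC ω (cub a) (cub k'))) := fun ω => mul_nonneg (hC.A_nonneg ω) (Real.exp_nonneg _)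
    have hb0 : ∀ ω, 0 ≤ (τ * AP ω) * Real.exp (-(ρP * DP ω (cub k') (cub k))) := fun ω => mul_nonneg (hτAP ω) (Real.exp_nonneg _)
    have ha : Summable fun ω => AC ω * Real.exp (-(ρC * DC ω (cub a) (cub k'))) := by
      refine summable_of_sum_le ha0 fun S => (Finset.sum_le_sum fun ω _ => ?_).trans (hC.majSum S (cub a) (cub k'))
      exact mul_le_mul_of_nonneg_left (Real.exp_le_exp.2 (neg_le_neg (mul_le_mul_of_nonneg_right
        (by linarith) (hC.D_nonneg ω _ _)))) (hC.A_nonneg ω)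
    have hb : Summable fun ω => (τ * AP ω) * Real.exp (-(ρP * DP ω (cub k') (cub k))) := by
      refine summable_of_sum_le hb0 fun S => (Finset.sum_le_sum fun ω _ => ?_).trans (hP'ms S (cub k') (cub k))
      exact mul_le_mul_of_nonneg_left (Real.exp_le_exp.2 (neg_le_neg (mul_le_mul_of_nonneg_right
        (by linarith) (hP.D_nonneg ω _ _)))) (hτAP ω)
    let f : WC → ℂ := fun ω => TC ω σ₀ u a k'
    let g : WP → ℂ := fun ω => ((-t) • TP ω σ₀ u) k' k
    have hfg : Summable fun x : WC × WP => f x.1 * g x.2 := by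
      refine Summable.of_norm_bounded (ha.mul_of_nonneg hb ha0 hb0) fun x => ?_
      refine (norm_mul_le (f x.1) (g x.2)).trans (mul_le_mul ?_ ?_ (norm_nonneg _) (ha0 x.1))
      · exact (norm_entry_le_blockNorm cub cub _ a k').trans (hC.majB x.1 σ₀ hσ₀ u hu (cub a) (cub k'))
      · exact (norm_entry_le_blockNorm cub cub _ k' k).trans (hP'B x.2 σ₀ hσ₀ u hu (cub k') (cub k))
    exact HasSum.mul (f := f) (g := g) (hC.hasSum σ₀ hσ₀ u hu a k') (hP'sum k' k) hfg
  have hSmaj : ∀ (ι' : WC × WP) a k, ‖(TC ι'.1 σ₀ u * ((-t) • TP ι'.2 σ₀ u)) a k‖ ≤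
      (c * (AC ι'.1 * (τ * AP ι'.2))) *
        Real.exp (-(ρs * infConv (g := toB6 (torusGeom K 0 0 0) 0 True) (DC ι'.1) (DP ι'.2) (cub a) (cub k))) :=
    fun ι' a k => (norm_entry_le_blockNorm cub cub _ a k).trans (hStepB ι' σ₀ hσ₀ u hu (cub a) (cub k))
  have hStepMSρs := majSumLe_mul (Nf := K) (C := c) (A₁ := AC) (A₂ := fun ω => τ * AP ω) (D₁ := DC) (D₂ := DP)
    (ρ := ρs) hC.A_nonneg hτAP (fun ω a b => (hdnn_torusGeom 0 0 0 a b).trans (hCdom ω a b))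
    (fun ω a b => (hdnn_torusGeom 0 0 0 a b).trans (hPdom ω a b)) (by linarith) (by linarith) hc hKC (mul_nonneg hτ hKP) hκs hκsP
    hκsC hrow' hC.majSum hP'ms
  have hMtot : ∀ (p : List (WC × WP) × WC) a b,
      ‖(p.1.foldr (fun i M => (TC i.1 σ₀ u * ((-t) • TP i.2 σ₀ u)) * M) (TC p.2 σ₀ u)) a b‖ ≤
        chainConst 1 c (fun i : WC × WP => c * (AC i.1 * (τ * AP i.2))) (AC p.2) p.1 *
          Real.exp (-(ρ * chainDist (g := toB6 (torusGeom K 0 0 0) 0 True)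
            (fun i : WC × WP => infConv (g := toB6 (torusGeom K 0 0 0) 0 True) (DC i.1) (DP i.2)) (DC p.2) p.1
              (cub a) (cub b))) :=
    fun p a b => (norm_entry_le_blockNorm cub cub _ a b).trans (hchainB p σ₀ hσ₀ u hu (cub a) (cub b))
  have hBtot : ∀ (F : Finset (List (WC × WP) × WC)) a b, ∑ p ∈ F,
      chainConst 1 c (fun i : WC × WP => c * (AC i.1 * (τ * AP i.2))) (AC p.2) p.1 *
        Real.exp (-(ρ * chainDist (g := toB6 (torusGeom K 0 0 0) 0 True)
          (fun i : WC × WP => infConv (g := toB6 (torusGeom K 0 0 0) 0 True) (DC i.1) (DP i.2)) (DC p.2) p.1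
            (cub a) (cub b))) ≤
      KbarC * (1 - c * (c * KbarC * (τ * KbarP) * c') * c')⁻¹ * Real.exp (-(κ * tdist1 K (cub a) (cub b))) :=
    fun F a b => hchainMS ρ (sub_le_self ρ hε) F (cub a) (cub b)
  have hlev := hasSum_levels (S := fun i : WC × WP => TC i.1 σ₀ u * ((-t) • TP i.2 σ₀ u)) (T := fun ω => TC ω σ₀ u)
    hSsum hSmaj (BS := fun a k => (c * KbarC * (τ * KbarP) * c') * Real.exp (-(κs * tdist1 K (cub a) (cub k))))
    (by intro F a k; simpa only [mul_assoc] using hStepMSρs F (cub a) (cub k))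
    (fun k b => hC.hasSum σ₀ hσ₀ u hu k b) hMtot hBtot i j
  have hid := one_sub_mul_tsum_eq (S := fun i : WC × WP => TC i.1 σ₀ u * ((-t) • TP i.2 σ₀ u)) (T := fun ω => TC ω σ₀ u)
    hSsum hSmaj (BS := fun a k => (c * KbarC * (τ * KbarP) * c') * Real.exp (-(κs * tdist1 K (cub a) (cub k))))
    (by intro F a k; simpa only [mul_assoc] using hStepMSρs F (cub a) (cub k))
    (fun k b => hC.hasSum σ₀ hσ₀ u hu k b) hMtot hBtot
  set Xm : Matrix n n ℂ := Matrix.of fun k b => ∑' p : List (WC × WP) × WC,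
    (p.1.foldr (fun i M => (TC i.1 σ₀ u * ((-t) • TP i.2 σ₀ u)) * M) (TC p.2 σ₀ u)) k b with hXdef
  have hK : A σ₀ u * (1 - Cm σ₀ u * ((-t) • Pm σ₀ u)) = A σ₀ u + t • Pm σ₀ u := by
    rw [Matrix.mul_sub, Matrix.mul_one, Matrix.mul_smul, Matrix.mul_smul, ← Matrix.mul_assoc, hAC σ₀ hσ₀ u hu,
      Matrix.one_mul, neg_smul, sub_neg_eq_add]
  have hinv : (A σ₀ u + t • Pm σ₀ u) * Xm = 1 := by
    rw [← hK, Matrix.mul_assoc, hid, hAC σ₀ hσ₀ u hu]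
  have hX : (A σ₀ u + t • Pm σ₀ u)⁻¹ = Xm := Matrix.inv_eq_right_inv hinv
  rw [hX, hXdef, Matrix.of_apply]
  exact hlev.1.hasSum

end Summit.QuantumFields.BalabanUV.Gaps.D4WalkBlockNeumann

end
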